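import Summits.BirchSwinnertonDyer.BirchSwinnertonDyer.Theorems.ClassRecordThreeEulerHalvesAtThreeWalkSupplySelmer
import Summits.BirchSwinnertonDyer.BirchSwinnertonDyer.Theorems.ClassRecordThreeEulerHalvesAtThreeKolyvaginFamilyDataDefs
import Summits.BirchSwinnertonDyer.BirchSwinnertonDyer.Theorems.ClassRecordThreeCornerAtThreeShimuraWalkDefs
import HarnessLib

/-!
# KUMMER MEMBERSHIP OF THE ROOT CLASSES `c_k(Q)`, `p^u • Q = P_n`, of a GENERALISED Kolyvagin datum `d : JET.KolyvaginFamilyData W K ι n`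
# off the conductor — the producer `hKum` of this seat's (P2) assembly `Koly.familyLevelSupply_of_memberships`, from Gross 6.2 (1) for the
# classes `c_M(n)` themselves (corner3-p2 g8's `ShimuraWalk.kolyvaginClass_familyData_mem_selmerLocalKer`, by hypothesis here) and the change of level
# (cell `bsd-stepL`, seat `bsd-stepL-tam3-p1` g13, owner of 19109's line; `--supports stmt-BirchSwinnertonDyer-19109 --as helper`)

HONEST FRAMING. Family twins (proofs verbatim; the datum enters through `toGeomPoints`, `pointsSubgroup`, `derivedPoint`,
`kolyvaginClass_def` only) of this seat's X₀(N) lemmas `Walk.torsionH1OfDvd_rootClass` ∕ `Walk.localization_rootClass_mem_kummer`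
(`…WalkSupplySelmer`) and of the place bookkeeping of bsd-jet's `JET.localization_kolyvaginClass_mem_kummerSelmerStructure_of_GZ31`,
for the GENERALISED datum (RULING 46 (P0′)); plus the assembly-shape producer. THEOREMS ONLY (no definition, no named fact, no `sorry`);
the standing inputs (admissibility at `p^{k+u}`, invariance of `[P_n]` mod `p^{k+u}`) and Gross 6.2 (1) for `c_{k+u}(n)` are HYPOTHESES;
nothing about any CM ∕ Heegner point is constructed; no stub closes; 0 classes move (T7); BSD is not proved by any of this.
WHAT.
* §1 `torsionH1OfDvd_rootClass`: `ι_* c_k(Q) = c_{k+u}(n)` for a `p^u`-th root `Q ∈ E(K[n])` of the derived point (the SAME McCallum cocycle: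
  corner-p1's `Koly.torsionH1OfDvd_kolyvaginClass_of_zsmul`).
* §2 `localization_rootClass_mem_kummerSelmerStructure`: at any place `v` of `K`, `loc_v c_k(Q) ∈ H¹_Kum(K_v, E[p^k])` as soon as
  `loc_v c_{k+u}(n) ∈ H¹_Kum(K_v, E[p^{k+u}])` — the local Kummer kernel is cartesian under `ι_*` (`mem_selmerLocalKer_iff_torsionH1OfDvd_mem`).
* §3 `localization_kolyvaginClass_mem_kummerSelmerStructure_of_forall_selmerLocalKer`: PLACE bookkeeping — from «`c_M(n) ∈ ker(H¹(K, E[p^M]) →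
  H¹(K_𝔳, E))` at every finite `𝔳 ∤ n`» (the output shape of corner3-p2's brick) to «`loc_v c_M(n) ∈ 𝓛^Kum_v` at every place `v` of `K` not
  over a prime factor of `n`» (the index set of the Kummer clause of `Jetchev2008.modifiedSelmerGroup`; complex places carry `H¹(ℂ, ·) = 0`).
* §4 `Koly.familyRootKummer_of_selmerLocalKer`: the producer `hKum` of `Koly.familyLevelSupply_of_memberships` VERBATIM (root classes at
  level `p^k`, `k ≥ 1`, Gross depth `≥ u + k` at the primes of `n`), from the assembly's own `hA` ∕ `hP` and Gross 6.2 (1) for `c_M(n)` at every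
  `M ≥ 1` in corner3-p2's finite-place shape (`hSel`).
References (locators only): [cite: McCallumLMS1991, §4 Lemma 4.1, Lemma 4.3, (6), Lemma 4.6] [cite: GrossLMS1991, §4 (4.4), (4.6), §6 Prop. 6.2 (1)]
[cite: Jetchev2008, §3.1 item 7 (p. 817), §3.3.1 (p. 816)] [cite: SilvermanAEC2009, X.§4 Remark 4.1.1].
presearch: not applicable (re-keying of tree theorems); `lean search 'rootClass_mem_kummerSelmerStructure|familyRootKummer'` → none.
Design: theorems only; `K : Type`. Axioms: `propext`, `Classical.choice`, `Quot.sound`.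
-/

set_option autoImplicit false

noncomputable section

open scoped Classical Pointwise
open Function NumberField IsDedekindDomain WeierstrassCurve Field
open Literature.NumberTheory.EllipticCurves Literature.NumberTheory.GaloisRepresentations
open Literature.NumberTheory.EllipticCurves.Jetchev2008 Literature.NumberTheory.EllipticCurves.KolyvaginCocycle
open Literature.NumberTheory.GaloisCohomology
open Summit.BirchSwinnertonDyer.Rank1Residual.JET.SelmerVocabulary
open Summit.BirchSwinnertonDyer.Rank1Residual.JET.GlobalDuality
open Summit.BirchSwinnertonDyer.Rank1Residual.X11b
open Summit.BirchSwinnertonDyer.BirchSwinnertonDyer.Theorems.ShimuraWalk (frobLevelIndex natCast_le_frobLevelIndex_iff)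

namespace Summit.BirchSwinnertonDyer.Rank1Residual.JET.KolyvaginFamilyData

variable {K : Type} [Field K] [NumberField K] {W : WeierstrassCurve ℚ} {ι : K →+* ℂ} {n : ℕ}
  (d : KolyvaginFamilyData W K ι n)

/-! ### §1 The change of level `ι_* c_k(Q) = c_{k+u}(n)` -/

/-- **`ι_* c_k(Q) = c_{k+u}(n)` for a `p^u`-th root `Q ∈ E(K[n])` of the derived point of a family datum** (the same McCallum cocycle),
given the standing inputs at level `p^{k+u}`. Twin of `Walk.torsionH1OfDvd_rootClass`. [cite: McCallumLMS1991, §4 Lemma 4.1, (6), Lemma 4.6]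
[cite: GrossLMS1991, §4 (4.4), (4.6)] -/
theorem torsionH1OfDvd_rootClass {p : ℕ} (hp : p.Prime) (k u : ℕ)
    (Q : (W.baseChange (ringClassField K ι n)).toAffine.Point)
    (hAk : IsAdmissible (absoluteGaloisGroup K) d.pointsSubgroup ((p ^ k : ℕ) : ℤ))
    (hQ : d.toGeomPoints Q ∈ invPoints (absoluteGaloisGroup K) d.pointsSubgroup ((p ^ k : ℕ) : ℤ))
    (hQP : ((p ^ u : ℕ) : ℤ) • Q = d.derivedPoint)
    (hA : IsAdmissible (absoluteGaloisGroup K) d.pointsSubgroup ((p ^ (k + u) : ℕ) : ℤ))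
    (hP : d.toGeomPoints d.derivedPoint ∈
      invPoints (absoluteGaloisGroup K) d.pointsSubgroup ((p ^ (k + u) : ℕ) : ℤ)) :
    WeierstrassCurve.torsionH1OfDvd (W.baseChange K)
        (show ((p ^ k : ℕ) : ℤ) ∣ ((p ^ (k + u) : ℕ) : ℤ) by
          exact_mod_cast pow_dvd_pow p (Nat.le_add_right k u))
        (_root_.Literature.NumberTheory.EllipticCurves.kolyvaginClass (W.baseChange K) ((p ^ k : ℕ) : ℤ)
          ((W.baseChange K).zsmul_geomPoints_surjective_of_charZero
            (by exact_mod_cast pow_ne_zero k hp.ne_zero)) hAk (d.toGeomPoints Q) hQ) =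
      d.kolyvaginClass hp (k + u) := by
  rw [d.kolyvaginClass_def hp (k + u), dif_pos ⟨hA, hP⟩]
  refine X11b.Three.Koly.torsionH1OfDvd_kolyvaginClass_of_zsmul
    (W.baseChange K) _ (m := ((p ^ u : ℕ) : ℤ)) ?_ _ _ hAk hA hQ ?_ hP
  · push_cast; ring
  · rw [← map_zsmul, hQP]

/-! ### §2 Kummer places for the root classes -/

/-- **The root class `c_k(Q)` is KUMMER at `v` wherever `c_{k+u}(n)` is** (family datum): the local Kummer kernel is cartesian under the
change of level `ι_*` and `ι_* c_k(Q) = c_{k+u}(n)`. Twin of `Walk.localization_rootClass_mem_kummer`. [cite: McCallumLMS1991, §4 Lemma 4.3, Lemma 4.6]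
[cite: SilvermanAEC2009, X.§4 (Remark 4.1.1)] -/
theorem localization_rootClass_mem_kummerSelmerStructure {p : ℕ} (hp : p.Prime) (k u : ℕ)
    (Q : (W.baseChange (ringClassField K ι n)).toAffine.Point)
    (hAk : IsAdmissible (absoluteGaloisGroup K) d.pointsSubgroup ((p ^ k : ℕ) : ℤ))
    (hQ : d.toGeomPoints Q ∈ invPoints (absoluteGaloisGroup K) d.pointsSubgroup ((p ^ k : ℕ) : ℤ))
    (hQP : ((p ^ u : ℕ) : ℤ) • Q = d.derivedPoint)
    (hA : IsAdmissible (absoluteGaloisGroup K) d.pointsSubgroup ((p ^ (k + u) : ℕ) : ℤ))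
    (hP : d.toGeomPoints d.derivedPoint ∈
      invPoints (absoluteGaloisGroup K) d.pointsSubgroup ((p ^ (k + u) : ℕ) : ℤ))
    (v : Place K)
    (hv : galoisCohomology.localization ((W.baseChange K).torsionGaloisModule ((p ^ (k + u) : ℕ) : ℤ)) v 1
        (d.kolyvaginClass hp (k + u)) ∈
      (W.baseChange K).kummerSelmerStructure ((p ^ (k + u) : ℕ) : ℤ) v) :
    galoisCohomology.localization ((W.baseChange K).torsionGaloisModule ((p ^ k : ℕ) : ℤ)) v 1
        (_root_.Literature.NumberTheory.EllipticCurves.kolyvaginClass (W.baseChange K) ((p ^ k : ℕ) : ℤ)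
          ((W.baseChange K).zsmul_geomPoints_surjective_of_charZero
            (by exact_mod_cast pow_ne_zero k hp.ne_zero)) hAk (d.toGeomPoints Q) hQ) ∈
      (W.baseChange K).kummerSelmerStructure ((p ^ k : ℕ) : ℤ) v := by
  have hdn : ((p ^ k : ℕ) : ℤ) ∣ ((p ^ (k + u) : ℕ) : ℤ) := by
    exact_mod_cast pow_dvd_pow p (Nat.le_add_right k u)
  have key : WeierstrassCurve.torsionH1OfDvd (W.baseChange K) hdn
      (_root_.Literature.NumberTheory.EllipticCurves.kolyvaginClass (W.baseChange K) ((p ^ k : ℕ) : ℤ)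
        ((W.baseChange K).zsmul_geomPoints_surjective_of_charZero
          (by exact_mod_cast pow_ne_zero k hp.ne_zero)) hAk (d.toGeomPoints Q) hQ) ∈
      selmerLocalKer (W.baseChange K) (Place.Completion v) ((p ^ (k + u) : ℕ) : ℤ) := by
    rw [d.torsionH1OfDvd_rootClass hp k u Q hAk hQ hQP hA hP,
      ← (W.baseChange K).comap_localization_kummerSelmerStructure]
    exact hv
  rw [← AddSubgroup.mem_comap, (W.baseChange K).comap_localization_kummerSelmerStructure]
  exact (Summit.BirchSwinnertonDyer.BirchSwinnertonDyer.Theorems.mem_selmerLocalKer_iff_torsionH1OfDvd_mem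
    (W.baseChange K) (Place.Completion v) hdn _).mpr key

/-! ### §3 Place bookkeeping: finite places off `n` ⟹ all places not over a prime factor of `n` -/

/-- **`loc_v c_M(n) ∈ 𝓛^Kum_v` at every place `v` of `K` not over a prime factor of the square-free conductor `n`**, from the membership
`c_M(n) ∈ ker(H¹(K, E[p^M]) → H¹(K_𝔳, E))` at every FINITE `𝔳 ∤ n` (complex places: `H¹(ℂ, ·) = 0`; finite places: the Kummer local condition
pulled back to `H¹(K, E[p^M])` is that kernel, `comap_localization_kummerSelmerStructure`). [cite: GrossLMS1991, §6 Prop. 6.2 (1)]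
[cite: Jetchev2008, §3.3.1 (p. 816)] -/
theorem localization_kolyvaginClass_mem_kummerSelmerStructure_of_forall_selmerLocalKer
    (hK : IsImaginaryQuadratic K) {p : ℕ} (hp : p.Prime) (M : ℕ) (hn : Squarefree n)
    (h : ∀ 𝔳 : HeightOneSpectrum (𝓞 K), (n : 𝓞 K) ∉ 𝔳.asIdeal →
      d.kolyvaginClass hp M ∈ selmerLocalKer (W.baseChange K) (𝔳.adicCompletion K) ((p ^ M : ℕ) : ℤ))
    (v : Place K) (hv : ∀ ℓ ∈ n.primeFactors, ¬ PlaceOver K v ℓ) :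
    galoisCohomology.localization ((W.baseChange K).torsionGaloisModule ((p ^ M : ℕ) : ℤ)) v 1
        (d.kolyvaginClass hp M) ∈
      (W.baseChange K).kummerSelmerStructure ((p ^ M : ℕ) : ℤ) v := by
  rcases v with w | 𝔳
  · -- complex place: `H¹(ℂ, ·) = 0`
    haveI : IsTotallyComplex K := hK.2
    have hw : w.IsComplex := IsTotallyComplex.isComplex w
    have htop := GlobalDuality.addSubgroup_galoisCohomology_inl_eq_top_of_isComplex
      ((W.baseChange K).torsionGaloisModule ((p ^ M : ℕ) : ℤ)) hw
      ((W.baseChange K).kummerSelmerStructure ((p ^ M : ℕ) : ℤ) (Sum.inl w))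
    rw [htop]
    exact AddSubgroup.mem_top _
  · -- finite place `𝔳 ∤ n`
    have hnv : (n : 𝓞 K) ∉ 𝔳.asIdeal := fun h' ↦ by
      obtain ⟨ℓ, hℓ, hℓv⟩ := exists_primeFactor_mem_of_natCast_mem hn 𝔳 h'
      exact hv ℓ hℓ ⟨𝔳, rfl, hℓv⟩
    rw [← AddSubgroup.mem_comap, (W.baseChange K).comap_localization_kummerSelmerStructure]
    exact h 𝔳 hnv

end Summit.BirchSwinnertonDyer.Rank1Residual.JET.KolyvaginFamilyData

/-! ### §4 The producer `hKum` of the (P2) assembly -/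

namespace Summit.BirchSwinnertonDyer.Rank1Residual.X11b.Three.Koly

open Summit.BirchSwinnertonDyer.Rank1Residual.JET

variable {K : Type} [Field K] [NumberField K] (W : WeierstrassCurve ℚ)

/-- **The producer `hKum` of `Koly.familyLevelSupply_of_memberships`, VERBATIM its hypothesis shape**: for every datum `d` of the family
(`d.y = ys n`, `n` square-free on Gross–Kolyvagin primes of depth `≥ k`), every level `k ≥ 1`, every `p^u`-th root `Q` of `P_n` with `[Q]`
invariant mod `p^k` and Gross depth `≥ u + k` at the primes of `n`, and every place `v` of `K` not over a prime factor of `n`: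
`loc_v c_k(Q) ∈ 𝓛^Kum_v` — from the family's standing inputs `hA` (admissibility at every depth) ∕ `hP` (invariance of `[P_n]` mod `p^j`,
`1 ≤ j ≤ M(n)`) and Gross 6.2 (1) for the classes `c_M(n)`, `M ≥ 1`, at the finite places off `n` (`hSel`, the output shape of corner3-p2's
`ShimuraWalk.kolyvaginClass_familyData_mem_selmerLocalKer` read datum by datum). [cite: GrossLMS1991, §6 Prop. 6.2 (1)]
[cite: McCallumLMS1991, §4 Lemma 4.3, Lemma 4.6] [cite: Jetchev2008, §3.1 item 7 (p. 817)] -/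
theorem familyRootKummer_of_selmerLocalKer (hK : IsImaginaryQuadratic K) (ι : K →+* ℂ) (p : ℕ) [Fact p.Prime]
    (ys : (m : ℕ) → (W.baseChange (ringClassField K ι m)).toAffine.Point)
    (hA : ∀ (n : ℕ) (d : KolyvaginFamilyData W K ι n), d.y = ys n → Squarefree n →
      (∀ q ∈ n.primeFactors, IsKolyvaginPrime (W.conductorNorm ℤ) W K p q) →
      ∀ j : ℕ, IsAdmissible (absoluteGaloisGroup K) d.pointsSubgroup ((p ^ j : ℕ) : ℤ))
    (hP : ∀ (n : ℕ) (d : KolyvaginFamilyData W K ι n), d.y = ys n → Squarefree n →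
      (∀ q ∈ n.primeFactors, IsKolyvaginPrime (W.conductorNorm ℤ) W K p q) →
      ∀ j : ℕ, 1 ≤ j → (j : ℕ∞) ≤ frobLevelIndex W K p n →
        d.toGeomPoints d.derivedPoint ∈ invPoints (absoluteGaloisGroup K) d.pointsSubgroup ((p ^ j : ℕ) : ℤ))
    (hSel : ∀ (M n : ℕ) (d : KolyvaginFamilyData W K ι n), 1 ≤ M → d.y = ys n → Squarefree n →
      (∀ q ∈ n.primeFactors, IsKolyvaginPrime (W.conductorNorm ℤ) W K p q ∧
        FrobEqFrobInfty W K (p ^ M) q) →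
      ∀ 𝔳 : HeightOneSpectrum (𝓞 K), (n : 𝓞 K) ∉ 𝔳.asIdeal →
        d.kolyvaginClass (Fact.out : p.Prime) M ∈
          selmerLocalKer (W.baseChange K) (𝔳.adicCompletion K) ((p ^ M : ℕ) : ℤ)) :
    ∀ (k n : ℕ) (d : KolyvaginFamilyData W K ι n), 1 ≤ k → d.y = ys n → Squarefree n →
      (∀ q ∈ n.primeFactors, IsKolyvaginPrime (W.conductorNorm ℤ) W K p q ∧
        FrobEqFrobInfty W K (p ^ k) q) →
      ∀ (u : ℕ) (Q : (W.baseChange (ringClassField K ι n)).toAffine.Point)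
        (hAk : IsAdmissible (absoluteGaloisGroup K) d.pointsSubgroup ((p ^ k : ℕ) : ℤ))
        (hQ : d.toGeomPoints Q ∈ invPoints (absoluteGaloisGroup K) d.pointsSubgroup ((p ^ k : ℕ) : ℤ)),
      ((p ^ u : ℕ) : ℤ) • Q = d.derivedPoint → ((u + k : ℕ) : ℕ∞) ≤ frobLevelIndex W K p n →
      ∀ v : Place K, (∀ ℓ ∈ n.primeFactors, ¬ PlaceOver K v ℓ) →
        galoisCohomology.localization ((W.baseChange K).torsionGaloisModule ((p ^ k : ℕ) : ℤ)) v 1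
          (kolyvaginClass (W.baseChange K) ((p ^ k : ℕ) : ℤ)
            ((W.baseChange K).zsmul_geomPoints_surjective_of_charZero
              (by exact_mod_cast pow_ne_zero k (Fact.out : p.Prime).ne_zero)) hAk (d.toGeomPoints Q) hQ) ∈
          (W.baseChange K).kummerSelmerStructure ((p ^ k : ℕ) : ℤ) v := by
  intro k n d hk hy hn hG u Q hAk hQ hQP huk v hv
  have hp : p.Prime := Fact.out
  have hKP : ∀ q ∈ n.primeFactors, IsKolyvaginPrime (W.conductorNorm ℤ) W K p q := fun q hq ↦ (hG q hq).1
  have hku : ((k + u : ℕ) : ℕ∞) ≤ frobLevelIndex W K p n := by rwa [Nat.add_comm] at huk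
  have hGku : ∀ q ∈ n.primeFactors, FrobEqFrobInfty W K (p ^ (k + u)) q :=
    (natCast_le_frobLevelIndex_iff hKP (k + u)).mp hku
  have hA' : IsAdmissible (absoluteGaloisGroup K) d.pointsSubgroup ((p ^ (k + u) : ℕ) : ℤ) := hA n d hy hn hKP (k + u)
  have hP' : d.toGeomPoints d.derivedPoint ∈
      invPoints (absoluteGaloisGroup K) d.pointsSubgroup ((p ^ (k + u) : ℕ) : ℤ) :=
    hP n d hy hn hKP (k + u) (le_add_right hk) hku
  refine d.localization_rootClass_mem_kummerSelmerStructure hp k u Q hAk hQ hQP hA' hP' v ?_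
  exact d.localization_kolyvaginClass_mem_kummerSelmerStructure_of_forall_selmerLocalKer hK hp (k + u) hn
    (hSel (k + u) n d (le_add_right hk) hy hn (fun q hq ↦ ⟨hKP q hq, hGku q hq⟩)) v hv

end Summit.BirchSwinnertonDyer.Rank1Residual.X11b.Three.Koly

end
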